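import Summits.AnomalousDissipation.AnomalousDissipation.Theorems.SawtoothPulseCascadeK2ParallelDatum
import Literature.Analysis.FunctionSpaces.TorusLinearisedNSForcedEnergy

/-!
# The heat-lag source of the cascade and its explicit parallel response on each half-slot
(route `AnomalousDissipation/SawtoothPulseCascade`; helper for the crux ApproxSol58 =
stmt-AnomalousDissipation-19688 — lead census (i) "explicit heat-lag solution on a half-slot" — and for
K2″ = stmt-AnomalousDissipation-19696; §4 of `SawtoothPulseCascadeK2ParallelShear` / `…HalfPulse` / `…Datum`)

The cascade carrier `ū` is not an exact Navier–Stokes solution: its residual is the HEAT LAG `νΔū`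
(`(ū·∇)ū = 0`, `∂ₜū` is the force).  The linearised response `L` of the K3loc line DriftFree solves the
FORCED linearised equations `∂ₜL + (ū·∇)L + (L·∇)ū = νΔL − ∇q + νΔū` (shape of the tree's
`Torus.linearisedNSForced_exists`, source `g = ν • laplacian ū`).  On the H half-slot of phase `j`,
`νΔū = ν rateH_j(t) U_j''(x₂) e₁` is a PARALLEL profile (`laplacian_field_of_mem_H`), so the forced
response created during the slot is explicit: a parallel forced heat flow.

* §4a `linearisedNSForced_parallelShear` (general shear slot on `𝕋²`, `k ≠ m`): if
  `∂ₜ|_S h = ν ∂²_y h + σ` then `W = h(t, x_k) e_m` solves the linearised equations along `c(t, x_k) e_m` with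
  pressure `0` and source `σ(t, x_k) e_m`;
* §4b `exists_heatProfile_forced`: forced heat profiles on `[a, b]` from smooth periodic data and a jointly
  smooth periodic source exist (tree well-posedness on `𝕋¹`, `ν > 0`);
* §4c cascade: `laplacian_field_of_mem_H/_V` (the heat-lag source on each slot),
  `exists_forcedParallel_H/_V` (for every smooth periodic datum profile there is an explicit parallel
  classical solution of the heat-lag-forced linearised equations on the slot), and the interface
  `forcedResponse_split_H/_V`: EVERY classical solution `(L, q)` of the heat-lag-forced linearised
  equations on the slot is `(L − W) + W` with `W` the parallel forced heat flow from ZERO datum and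
  `(L − W, q)` a classical solution of the HOMOGENEOUS linearised equations with the same datum `L(slot
  start)` (tree linearity `Torus.linearisedNSForced_sub_eq`) — "forced response on a slot = homogeneous
  evolution of the entering state + explicit parallel forced heat flow".
-/

-- `Summit.<Summit>.<Problem>` is the tree's mandated summit-side namespace (CONVENTIONS §2); for this
-- single-conjunct summit the two coincide, so the duplicate is deliberate (lakefile: off for `Summits`).
set_option linter.dupNamespace false

noncomputable section

namespace Summit.AnomalousDissipation.AnomalousDissipation.Theorems.SawtoothPulseCascade.K2Classical

open Set MeasureTheory
open scoped InnerProductSpace ContDiff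
open Literature.Analysis Literature.Analysis.FunctionSpaces Literature.Analysis.FluidPDE
open Literature.Analysis.FluidPDE.SawtoothCascade
open Literature.Analysis.FluidPDE.SawtoothCascade.CascadeParams

/-! ## §4a Forced parallel profiles along a shear -/

section General

variable {k m : Fin 2}

/-- **Forced parallel heat profiles solve the forced linearised equations along a shear.** As
`linearisedNS_parallelShear`, with a source: if `∂ₜ|_S h = ν ∂²_y h + σ` then `W(t, x) = h(t, x_k) e_m`
satisfies `∂ₜ|_S W + (ū·∇)W + (W·∇)ū = νΔW − ∇0 + σ(t, x_k) e_m` along `ū = c(t, x_k) e_m`, `k ≠ m`. -/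
theorem linearisedNSForced_parallelShear (hkm : k ≠ m) {S : Set ℝ} (hS : UniqueDiffOn ℝ S) {ν : ℝ}
    {u : ℝ → UnitAddTorus (Fin 2) → EuclideanSpace ℝ (Fin 2)} {c : ℝ → ℝ → ℝ}
    (hu : ∀ t ∈ S, u t = fun y => c t (Torus.repr y k) • EuclideanSpace.single m (1 : ℝ))
    (hcper : ∀ t ∈ S, Function.Periodic (c t) 1) (hcs : ∀ t ∈ S, ContDiff ℝ ∞ (c t))
    {h σ : ℝ → ℝ → ℝ} (hh : ContDiffOn ℝ ∞ (Function.uncurry h) (S ×ˢ univ))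
    (hper : ∀ t ∈ S, Function.Periodic (h t) 1)
    (heat : ∀ t ∈ S, ∀ y, derivWithin (fun τ => h τ y) S t = ν * deriv (deriv (h t)) y + σ t y) :
    ∀ t ∈ S, ∀ x,
      Torus.timeDerivWithin S
          (fun τ (y : UnitAddTorus (Fin 2)) => h τ (Torus.repr y k) • EuclideanSpace.single m (1 : ℝ)) t x +
        Torus.convect (u t) (fun y => h t (Torus.repr y k) • EuclideanSpace.single m (1 : ℝ)) x +
        Torus.convect (fun y => h t (Torus.repr y k) • EuclideanSpace.single m (1 : ℝ)) (u t) x =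
      ν • Torus.laplacian (fun y => h t (Torus.repr y k) • EuclideanSpace.single m (1 : ℝ)) x -
        Torus.gradient (fun _ : UnitAddTorus (Fin 2) => (0 : ℝ)) x +
        σ t (Torus.repr x k) • EuclideanSpace.single m (1 : ℝ) := by
  intro t ht x
  have hhs := contDiff_slice_of_contDiffOn_uncurry hh ht
  rw [timeDerivWithin_parallelShear hS hh ht x, hu t ht,
    convect_shear_parallelShear hkm (hper t ht) hhs x,
    convect_parallelShear_shear hkm (hcper t ht) (hcs t ht) x,
    laplacian_parallelShear hkm (hper t ht) hhs x, gradient_zero_fun x, heat t ht]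
  rw [add_zero, add_zero, sub_zero, smul_smul, add_smul]

end General

/-! ## §4b Forced heat profiles on a compact time interval -/

/-- A `1`-periodic function read through `𝕋¹`: `G (repr (proj (y e₀)) 0) = G y`. -/
private theorem coordFun_proj_smul_single' {F : Type*} {G : ℝ → F} (hG : Function.Periodic G 1)
    (y : ℝ) : G (Torus.repr (Torus.proj (y • EuclideanSpace.single (0 : Fin 1) (1 : ℝ))) 0) = G y := by
  have h := Torus.lift_coordFun_apply hG (0 : Fin 1) (y • EuclideanSpace.single (0 : Fin 1) (1 : ℝ))
  rw [Torus.lift_apply] at h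
  simpa using h

/-- The derivative of a `1`-periodic function is `1`-periodic. -/
private theorem periodic_deriv'' {g : ℝ → ℝ} (hg : Function.Periodic g 1) :
    Function.Periodic (deriv g) 1 := by
  intro s
  have h : (fun x => g (x + 1)) = g := funext hg
  rw [← deriv_comp_add_const g 1 s, h]

/-- **Forced heat profiles exist.** For `a < b`, `ν > 0`, a smooth `1`-periodic datum `g` and a source
`σ` jointly smooth on `[a, b] × ℝ` and `1`-periodic in space there is `h`, jointly smooth on `[a, b] × ℝ`,
`1`-periodic in space, with `∂ₜ|_{[a,b]} h = ν ∂²_y h + σ` pointwise and `h(a, ·) = g` (the tree's classical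
well-posedness of the forced heat equation on `𝕋¹`,
`Torus.exists_unique_isClassicalScalarTransportForcedOn_holds`, read on the coordinate and translated). -/
theorem exists_heatProfile_forced {a b : ℝ} (hab : a < b) {ν : ℝ} (hν : 0 < ν) {g : ℝ → ℝ}
    (hg : ContDiff ℝ ∞ g) (hgper : Function.Periodic g 1) {σ : ℝ → ℝ → ℝ}
    (hσ : ContDiffOn ℝ ∞ (Function.uncurry σ) (Icc a b ×ˢ univ))
    (hσper : ∀ t ∈ Icc a b, Function.Periodic (σ t) 1) :
    ∃ h : ℝ → ℝ → ℝ, ContDiffOn ℝ ∞ (Function.uncurry h) (Icc a b ×ˢ univ) ∧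
      (∀ t ∈ Icc a b, Function.Periodic (h t) 1) ∧
      (∀ t ∈ Icc a b, ∀ y,
        derivWithin (fun τ => h τ y) (Icc a b) t = ν * deriv (deriv (h t)) y + σ t y) ∧
      h a = g := by
  set T : ℝ := b - a with hT_def
  have hT : 0 < T := sub_pos.2 hab
  have hcoord : ContDiff ℝ ∞ fun v : EuclideanSpace ℝ (Fin 1) => v 0 := contDiff_euclidean.1 contDiff_id 0
  -- the datum and the source on `𝕋¹ × [0, T]`
  set θ₀ : UnitAddTorus (Fin 1) → ℝ := fun x => g (Torus.repr x 0) with hθ₀_def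
  have hθ₀ : Torus.IsSmooth θ₀ := by
    have hl : Torus.lift θ₀ = fun v => g (v 0) := funext fun v => Torus.lift_coordFun_apply hgper 0 v
    unfold Torus.IsSmooth
    rw [hl]
    exact hg.comp hcoord
  set s : ℝ → UnitAddTorus (Fin 1) → ℝ := fun τ x => σ (τ + a) (Torus.repr x 0) with hs_def
  have hs : Torus.IsSmoothSpaceTimeOn (Icc 0 T) s := by
    have hφ : ContDiff ℝ ∞ (fun z : ℝ × EuclideanSpace ℝ (Fin 1) => (z.1 + a, z.2 0)) :=
      (contDiff_fst.add contDiff_const).prodMk (hcoord.comp contDiff_snd)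
    have hmaps : MapsTo (fun z : ℝ × EuclideanSpace ℝ (Fin 1) => (z.1 + a, z.2 0)) (Icc 0 T ×ˢ univ)
        (Icc a b ×ˢ univ) := by
      intro z hz
      have hz1 : z.1 ∈ Icc 0 T := (mem_prod.1 hz).1
      exact mk_mem_prod ⟨by linarith [hz1.1], by rw [hT_def] at hz1; linarith [hz1.2]⟩ (mem_univ _)
    have hcomp := hσ.comp hφ.contDiffOn hmaps
    unfold Torus.IsSmoothSpaceTimeOn
    refine hcomp.congr fun z hz => ?_
    have hz1 : z.1 ∈ Icc 0 T := (mem_prod.1 hz).1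
    have hza : z.1 + a ∈ Icc a b := ⟨by linarith [hz1.1], by rw [hT_def] at hz1; linarith [hz1.2]⟩
    rw [Torus.stLift_apply]
    show σ (z.1 + a) (Torus.repr (Torus.proj z.2) 0) = Function.uncurry σ (z.1 + a, z.2 0)
    have h1 := Torus.lift_coordFun_apply (hσper (z.1 + a) hza) (0 : Fin 1) z.2
    rw [Torus.lift_apply] at h1
    exact h1
  -- zero drift
  have hu : Torus.IsSmoothSpaceTimeOn (Icc 0 T)
      (fun (_ : ℝ) (_ : UnitAddTorus (Fin 1)) => (0 : EuclideanSpace ℝ (Fin 1))) :=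
    Torus.isSmoothSpaceTimeOn_const (Torus.isSmooth_const _) _
  have hdiv : ∀ t ∈ Icc 0 T, Torus.IsDivFree
      ((fun (_ : ℝ) (_ : UnitAddTorus (Fin 1)) => (0 : EuclideanSpace ℝ (Fin 1))) t) := fun t _ x => by
    simp [Torus.divergence, Torus.partialDeriv, Torus.lineDeriv]
  obtain ⟨θ, hθ, hθ0, -⟩ :=
    Literature.Analysis.FluidPDE.Torus.exists_unique_isClassicalScalarTransportForcedOn_holds (d := Fin 1)
      hν hT hu hdiv hs hθ₀
  -- the profile `h t y = θ (t - a) (proj (y e₀))`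
  set e : ℝ → EuclideanSpace ℝ (Fin 1) := fun y => y • EuclideanSpace.single (0 : Fin 1) (1 : ℝ) with he
  have hecd : ContDiff ℝ ∞ e := contDiff_id.smul contDiff_const
  set h : ℝ → ℝ → ℝ := fun t y => θ (t + -a) (Torus.proj (e y)) with hh_def
  have hpre : (· + -a) ⁻¹' Icc 0 T = Icc a b := by
    rw [Literature.Analysis.FluidPDE.Torus.preimage_add_const_Icc', hT_def]
    congr 1 <;> ring
  have hper : ∀ t, Function.Periodic (h t) 1 := by
    intro t y
    have h1 : e (y + 1) = e y + Torus.latticeVec (fun _ : Fin 1 => (1 : ℤ)) := by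
      ext i
      fin_cases i
      simp [he]
    show θ (t + -a) (Torus.proj (e (y + 1))) = θ (t + -a) (Torus.proj (e y))
    rw [h1, Torus.proj_add_latticeVec]
  have hev : ∀ v : EuclideanSpace ℝ (Fin 1), e (v 0) = v := fun v => by
    ext i
    fin_cases i
    simp [he]
  have hslice : ∀ r, θ r = fun x => h (r + a) (Torus.repr x 0) := by
    intro r
    funext x
    simp only [hh_def]
    rw [add_neg_cancel_right, hev, Torus.proj_repr]
  refine ⟨h, ?_, fun t _ => hper t, fun t ht y => ?_, ?_⟩
  · have hφ : ContDiff ℝ ∞ (fun p : ℝ × ℝ => (p.1 + -a, e p.2)) :=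
      (contDiff_fst.add contDiff_const).prodMk (hecd.comp contDiff_snd)
    have hmaps : MapsTo (fun p : ℝ × ℝ => (p.1 + -a, e p.2)) (Icc a b ×ˢ univ) (Icc 0 T ×ˢ univ) := by
      intro p hp
      have hp1 : p.1 ∈ Icc a b := (mem_prod.1 hp).1
      exact mk_mem_prod ⟨by linarith [hp1.1], by rw [hT_def]; linarith [hp1.2]⟩ (mem_univ _)
    exact (hθ.smooth_scalar.comp hφ.contDiffOn hmaps).congr fun p _ => rfl
  · have ht' : t + -a ∈ Icc 0 T := ⟨by linarith [ht.1], by rw [hT_def]; linarith [ht.2]⟩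
    have hD := Literature.Analysis.FluidPDE.Torus.timeDerivWithin_comp_add_const (Icc 0 T) θ (-a) t
      (Torus.proj (e y))
    rw [hpre] at hD
    have hLHS : derivWithin (fun τ => h τ y) (Icc a b) t =
        Torus.timeDerivWithin (Icc a b) (fun r => θ (r + -a)) t (Torus.proj (e y)) := rfl
    rw [hLHS, hD]
    have htr := hθ.transport (t + -a) ht' (Torus.proj (e y))
    simp only [inner_zero_left, add_zero] at htr
    rw [htr]
    have hHper : Function.Periodic (h t) 1 := hper t
    have hlap : Torus.laplacian (θ (t + -a)) (Torus.proj (e y)) = deriv (deriv (h t)) y := by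
      rw [Torus.laplacian_eq_sum_partialDeriv_partialDeriv (hθ.smooth_scalar.isSmooth_slice ht'),
        Fin.sum_univ_one, hslice (t + -a), neg_add_cancel_right]
      have h1 : Torus.partialDeriv 0 (fun x : UnitAddTorus (Fin 1) => h t (Torus.repr x 0)) =
          fun x => deriv (h t) (Torus.repr x 0) :=
        funext fun x => Torus.partialDeriv_coordFun_self hHper 0 x
      rw [h1, Torus.partialDeriv_coordFun_self (periodic_deriv'' hHper) 0]
      exact coordFun_proj_smul_single' (periodic_deriv'' (periodic_deriv'' hHper)) y
    have hsrc : s (t + -a) (Torus.proj (e y)) = σ t y := by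
      show σ (t + -a + a) (Torus.repr (Torus.proj (e y)) 0) = σ t y
      rw [neg_add_cancel_right]
      exact coordFun_proj_smul_single' (hσper t ht) y
    rw [hlap, hsrc]
  · funext y
    show θ (a + -a) (Torus.proj (e y)) = g y
    rw [add_neg_cancel, hθ0]
    exact coordFun_proj_smul_single' hgper y

/-! ## §4c The cascade: the heat-lag source and its explicit parallel response -/

/-- `(c · U)'' = c · U''` for the smooth cascade profile. -/
private theorem deriv_deriv_const_mul_U (P : CascadeParams) {j : ℕ} (hδ : 0 < P.δ j) (c : ℝ) :
    deriv (deriv fun y => c * P.U j y) = fun y => c * deriv (deriv (P.U j)) y := by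
  have hU : ContDiff ℝ ∞ (P.U j) := P.contDiff_U hδ
  have hU' : ContDiff ℝ ∞ (deriv (P.U j)) := by simpa using hU.iterate_deriv 1
  have h1 : deriv (fun y => c * P.U j y) = fun y => c * deriv (P.U j) y := by
    funext y
    exact deriv_const_mul c (hU.differentiable (by simp) y)
  rw [h1]
  funext y
  exact deriv_const_mul c (hU'.differentiable (by simp) y)

/-- **The heat-lag source on the H half-slot**: `Δū(t, x) = rateH_j(t) U_j''(x₂) e₁`. -/
theorem laplacian_field_of_mem_H (P : CascadeParams) (hδ₀ : 0 < P.δ₀) (hd : 0 < P.d) {j : ℕ} {t : ℝ}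
    (ht : t ∈ Icc (tStart j) (tStart j + tHalf j)) (x : UnitAddTorus (Fin 2)) :
    Torus.laplacian (P.field t) x =
      (P.rateH j t * deriv (deriv (P.U j)) (Torus.repr x 1)) • EuclideanSpace.single (0 : Fin 2) (1 : ℝ) := by
  rw [field_eq_parallel_H P ht, laplacian_parallelShear (k := 1) (m := 0) (by decide)
    (g := fun y => P.rateH j t * P.U j y) (fun y => by simp only [P.U_periodic j y])
    (contDiff_const.mul (P.contDiff_U (P.δ_pos hδ₀ hd j))) x,
    deriv_deriv_const_mul_U P (P.δ_pos hδ₀ hd j)]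

/-- **The heat-lag source on the V half-slot**: `Δū(t, x) = rateV_j(t) U_j''(x₁) e₂`. -/
theorem laplacian_field_of_mem_V (P : CascadeParams) (hδ₀ : 0 < P.δ₀) (hd : 0 < P.d) {j : ℕ} {t : ℝ}
    (ht : t ∈ Icc (tStart j + tHalf j) (tStart (j + 1))) (x : UnitAddTorus (Fin 2)) :
    Torus.laplacian (P.field t) x =
      (P.rateV j t * deriv (deriv (P.U j)) (Torus.repr x 0)) • EuclideanSpace.single (1 : Fin 2) (1 : ℝ) := by
  rw [field_eq_parallel_V P ht, laplacian_parallelShear (k := 0) (m := 1) (by decide)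
    (g := fun y => P.rateV j t * P.U j y) (fun y => by simp only [P.U_periodic j y])
    (contDiff_const.mul (P.contDiff_U (P.δ_pos hδ₀ hd j))) x,
    deriv_deriv_const_mul_U P (P.δ_pos hδ₀ hd j)]

/-- The heat-lag source profile `(t, y) ↦ ν rate(t) U_j''(y)` is jointly smooth (any smooth rate). -/
private theorem contDiffOn_source (P : CascadeParams) {j : ℕ} (hδ : 0 < P.δ j) (ν : ℝ) {r : ℝ → ℝ}
    (hr : ContDiff ℝ ∞ r) (S : Set ℝ) :
    ContDiffOn ℝ ∞ (Function.uncurry fun t y => ν * (r t * deriv (deriv (P.U j)) y)) (S ×ˢ univ) := by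
  have hU'' : ContDiff ℝ ∞ (deriv (deriv (P.U j))) := by
    simpa using (P.contDiff_U hδ).iterate_deriv 2
  exact (contDiff_const.mul ((hr.comp contDiff_fst).mul (hU''.comp contDiff_snd))).contDiffOn

/-- **Explicit parallel response to the heat lag on the H half-slot.** For `δ₀ > 0`, `d > 0`, `ν > 0` and
every smooth `1`-periodic datum profile `g` there is a heat profile `h` on the H half-slot of phase `j`
(jointly smooth, `1`-periodic, `h(tStart j, ·) = g`, `∂ₜ|_slot h = ν ∂²_y h + ν rateH_j U_j''`) whose
parallel field `W = h(t, x₂) e₁` is a classical solution of the heat-lag-FORCED linearised equations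
`∂ₜ|_slot W + (ū·∇)W + (W·∇)ū = νΔW − ∇0 + νΔū` on the slot (pressure `0`), jointly smooth and
divergence free. -/
theorem exists_forcedParallel_H (P : CascadeParams) (hδ₀ : 0 < P.δ₀) (hd : 0 < P.d) {j : ℕ} {ν : ℝ}
    (hν : 0 < ν) {g : ℝ → ℝ} (hg : ContDiff ℝ ∞ g) (hgper : Function.Periodic g 1) :
    ∃ h : ℝ → ℝ → ℝ, ContDiffOn ℝ ∞ (Function.uncurry h) (Icc (tStart j) (tStart j + tHalf j) ×ˢ univ) ∧
      (∀ t ∈ Icc (tStart j) (tStart j + tHalf j), Function.Periodic (h t) 1) ∧ h (tStart j) = g ∧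
      Torus.IsSmoothSpaceTimeOn (Icc (tStart j) (tStart j + tHalf j))
        (fun t (y : UnitAddTorus (Fin 2)) => h t (Torus.repr y 1) • EuclideanSpace.single (0 : Fin 2) (1 : ℝ)) ∧
      (∀ t ∈ Icc (tStart j) (tStart j + tHalf j), Torus.IsDivFree
        (fun y : UnitAddTorus (Fin 2) => h t (Torus.repr y 1) • EuclideanSpace.single (0 : Fin 2) (1 : ℝ))) ∧
      ∀ t ∈ Icc (tStart j) (tStart j + tHalf j), ∀ x,
        Torus.timeDerivWithin (Icc (tStart j) (tStart j + tHalf j))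
            (fun τ (y : UnitAddTorus (Fin 2)) => h τ (Torus.repr y 1) • EuclideanSpace.single (0 : Fin 2) (1 : ℝ))
            t x +
          Torus.convect (P.field t) (fun y => h t (Torus.repr y 1) • EuclideanSpace.single (0 : Fin 2) (1 : ℝ)) x +
          Torus.convect (fun y => h t (Torus.repr y 1) • EuclideanSpace.single (0 : Fin 2) (1 : ℝ)) (P.field t) x =
        ν • Torus.laplacian (fun y => h t (Torus.repr y 1) • EuclideanSpace.single (0 : Fin 2) (1 : ℝ)) x -
          Torus.gradient (fun _ : UnitAddTorus (Fin 2) => (0 : ℝ)) x + ν • Torus.laplacian (P.field t) x := by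
  have hlt : tStart j < tStart j + tHalf j := by linarith [tHalf_pos j]
  have hδ := P.δ_pos hδ₀ hd j
  obtain ⟨h, hh, hper, heat, ha⟩ := exists_heatProfile_forced hlt hν hg hgper
    (contDiffOn_source P hδ ν (P.contDiff_rateH j) _)
    (fun t _ y => by simp only [(periodic_deriv'' (periodic_deriv'' (P.U_periodic j))) y])
  refine ⟨h, hh, hper, ha, isSmoothSpaceTimeOn_parallelShear hh hper,
    fun t ht => isDivFree_parallelShear (k := 1) (m := 0) (by decide) (hper t ht), fun t ht x => ?_⟩
  rw [linearisedNSForced_parallelShear (k := 1) (m := 0) (by decide) (uniqueDiffOn_Icc hlt) (u := P.field)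
    (c := fun t y => P.rateH j t * P.U j y) (fun _ hs => field_eq_parallel_H P hs)
    (fun t _ y => by simp only [P.U_periodic j y])
    (fun _ _ => contDiff_const.mul (P.contDiff_U hδ)) hh hper heat t ht x,
    laplacian_field_of_mem_H P hδ₀ hd ht x, smul_smul]

/-- **Explicit parallel response to the heat lag on the V half-slot**: as `exists_forcedParallel_H` on
`[tStart j + tHalf j, tStart (j+1)]` with the vertical parallel field `h(t, x₁) e₂`. -/
theorem exists_forcedParallel_V (P : CascadeParams) (hδ₀ : 0 < P.δ₀) (hd : 0 < P.d) {j : ℕ} {ν : ℝ}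
    (hν : 0 < ν) {g : ℝ → ℝ} (hg : ContDiff ℝ ∞ g) (hgper : Function.Periodic g 1) :
    ∃ h : ℝ → ℝ → ℝ,
      ContDiffOn ℝ ∞ (Function.uncurry h) (Icc (tStart j + tHalf j) (tStart (j + 1)) ×ˢ univ) ∧
      (∀ t ∈ Icc (tStart j + tHalf j) (tStart (j + 1)), Function.Periodic (h t) 1) ∧
      h (tStart j + tHalf j) = g ∧
      Torus.IsSmoothSpaceTimeOn (Icc (tStart j + tHalf j) (tStart (j + 1)))
        (fun t (y : UnitAddTorus (Fin 2)) => h t (Torus.repr y 0) • EuclideanSpace.single (1 : Fin 2) (1 : ℝ)) ∧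
      (∀ t ∈ Icc (tStart j + tHalf j) (tStart (j + 1)), Torus.IsDivFree
        (fun y : UnitAddTorus (Fin 2) => h t (Torus.repr y 0) • EuclideanSpace.single (1 : Fin 2) (1 : ℝ))) ∧
      ∀ t ∈ Icc (tStart j + tHalf j) (tStart (j + 1)), ∀ x,
        Torus.timeDerivWithin (Icc (tStart j + tHalf j) (tStart (j + 1)))
            (fun τ (y : UnitAddTorus (Fin 2)) => h τ (Torus.repr y 0) • EuclideanSpace.single (1 : Fin 2) (1 : ℝ))
            t x +
          Torus.convect (P.field t) (fun y => h t (Torus.repr y 0) • EuclideanSpace.single (1 : Fin 2) (1 : ℝ)) x +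
          Torus.convect (fun y => h t (Torus.repr y 0) • EuclideanSpace.single (1 : Fin 2) (1 : ℝ)) (P.field t) x =
        ν • Torus.laplacian (fun y => h t (Torus.repr y 0) • EuclideanSpace.single (1 : Fin 2) (1 : ℝ)) x -
          Torus.gradient (fun _ : UnitAddTorus (Fin 2) => (0 : ℝ)) x + ν • Torus.laplacian (P.field t) x := by
  have hlt : tStart j + tHalf j < tStart (j + 1) := by rw [tStart_succ]; linarith [tHalf_pos j]
  have hδ := P.δ_pos hδ₀ hd j
  obtain ⟨h, hh, hper, heat, ha⟩ := exists_heatProfile_forced hlt hν hg hgper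
    (contDiffOn_source P hδ ν (P.contDiff_rateV j) _)
    (fun t _ y => by simp only [(periodic_deriv'' (periodic_deriv'' (P.U_periodic j))) y])
  refine ⟨h, hh, hper, ha, isSmoothSpaceTimeOn_parallelShear hh hper,
    fun t ht => isDivFree_parallelShear (k := 0) (m := 1) (by decide) (hper t ht), fun t ht x => ?_⟩
  rw [linearisedNSForced_parallelShear (k := 0) (m := 1) (by decide) (uniqueDiffOn_Icc hlt) (u := P.field)
    (c := fun t y => P.rateV j t * P.U j y) (fun _ hs => field_eq_parallel_V P hs)
    (fun t _ y => by simp only [P.U_periodic j y])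
    (fun _ _ => contDiff_const.mul (P.contDiff_U hδ)) hh hper heat t ht x,
    laplacian_field_of_mem_V P hδ₀ hd ht x, smul_smul]

/-- **Forced response on the H half-slot = homogeneous evolution + explicit parallel forced heat flow.**
For `δ₀ > 0`, `d > 0`, `ν > 0` and every classical solution `(L, q)` of the heat-lag-forced linearised
equations on the H half-slot of phase `j` there is a horizontal parallel field `W = h(t, x₂) e₁` with
`W(tStart j) = 0`, jointly smooth and divergence free on the slot, such that `(L − W, q)` is a classical
solution of the HOMOGENEOUS linearised equations there (same datum `L(tStart j)`). -/
theorem forcedResponse_split_H (P : CascadeParams) (hδ₀ : 0 < P.δ₀) (hd : 0 < P.d) {j : ℕ} {ν : ℝ}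
    (hν : 0 < ν) {L : ℝ → UnitAddTorus (Fin 2) → EuclideanSpace ℝ (Fin 2)}
    {q : ℝ → UnitAddTorus (Fin 2) → ℝ}
    (hL : Torus.IsSmoothSpaceTimeOn (Icc (tStart j) (tStart j + tHalf j)) L)
    (hq : Torus.IsSmoothSpaceTimeOn (Icc (tStart j) (tStart j + tHalf j)) q)
    (hlin : ∀ t ∈ Icc (tStart j) (tStart j + tHalf j), ∀ x,
      Torus.timeDerivWithin (Icc (tStart j) (tStart j + tHalf j)) L t x + Torus.convect (P.field t) (L t) x +
        Torus.convect (L t) (P.field t) x =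
          ν • Torus.laplacian (L t) x - Torus.gradient (q t) x + ν • Torus.laplacian (P.field t) x) :
    ∃ h : ℝ → ℝ → ℝ, (∀ t ∈ Icc (tStart j) (tStart j + tHalf j), Function.Periodic (h t) 1) ∧
      h (tStart j) = (fun _ => 0) ∧
      Torus.IsSmoothSpaceTimeOn (Icc (tStart j) (tStart j + tHalf j))
        (fun t (y : UnitAddTorus (Fin 2)) => h t (Torus.repr y 1) • EuclideanSpace.single (0 : Fin 2) (1 : ℝ)) ∧
      (∀ t ∈ Icc (tStart j) (tStart j + tHalf j), Torus.IsDivFree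
        (fun y : UnitAddTorus (Fin 2) => h t (Torus.repr y 1) • EuclideanSpace.single (0 : Fin 2) (1 : ℝ))) ∧
      ∀ t ∈ Icc (tStart j) (tStart j + tHalf j), ∀ x,
        Torus.timeDerivWithin (Icc (tStart j) (tStart j + tHalf j))
            (fun s y => L s y - h s (Torus.repr y 1) • EuclideanSpace.single (0 : Fin 2) (1 : ℝ)) t x +
          Torus.convect (P.field t)
            (fun y => L t y - h t (Torus.repr y 1) • EuclideanSpace.single (0 : Fin 2) (1 : ℝ)) x +
          Torus.convect (fun y => L t y - h t (Torus.repr y 1) • EuclideanSpace.single (0 : Fin 2) (1 : ℝ))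
            (P.field t) x =
        ν • Torus.laplacian
            (fun y => L t y - h t (Torus.repr y 1) • EuclideanSpace.single (0 : Fin 2) (1 : ℝ)) x -
          Torus.gradient (fun y => q t y - (fun (_ : ℝ) (_ : UnitAddTorus (Fin 2)) => (0 : ℝ)) t y) x := by
  have hlt : tStart j < tStart j + tHalf j := by linarith [tHalf_pos j]
  obtain ⟨h, hh, hper, ha, hWs, hWdiv, hWlin⟩ :=
    exists_forcedParallel_H P hδ₀ hd (j := j) hν contDiff_const (fun _ => rfl : Function.Periodic (fun _ : ℝ => (0 : ℝ)) 1)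
  have hqs : Torus.IsSmoothSpaceTimeOn (Icc (tStart j) (tStart j + tHalf j))
      (fun (_ : ℝ) (_ : UnitAddTorus (Fin 2)) => (0 : ℝ)) :=
    Torus.isSmoothSpaceTimeOn_const (Torus.isSmooth_const (0 : ℝ)) _
  refine ⟨h, hper, ha, hWs, hWdiv, fun t ht x => ?_⟩
  have hsub := Torus.linearisedNSForced_sub_eq hL hq hlin hWs hqs hWlin hlt ht x
  rw [sub_self, add_zero] at hsub
  exact hsub

end Summit.AnomalousDissipation.AnomalousDissipation.Theorems.SawtoothPulseCascade.K2Classical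

end
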